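import Mathlib
import HarnessLib
import Literature.MathematicalPhysics.StatisticalMechanics.RenormalisationMapLipschitzWeak

/-!
# The weak-norm Lipschitz bound of `S_k` with the GAIN kept on the large top term
# ([ABKM19] Thm 6.8 / Ch. 12 (12.4)), torus data

`RenormalisationMapLipschitzWeak.weakNormLE_nextKStep_sub_abkm` converts the raw per-polymer bound
`tayNormLE_nextKStep_sub_abkm_raw` to the weak norm at scale `k+1`; for the top part of the large
remainder `Σ₂ᴸ` (the summand `κ^{|U|_k}(2Δ' + C_Δ)·c₂^{|U|_{k+1}}A^{−η|U|_{k+1}}`) it used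
`pow_mul_rpow_le_inv_pow'`, i.e. `(κ^{L^d}c₂A^{−(η−1)})^{|U|_{k+1}} ≤ 1`, so that the constant carries the
bare term `2Δ' + C_Δ` — whose `C_Δ`-coefficient is `≥ 1`, too weak for the contraction `σ ≤ κη < 1`
of the fine tuning (`RGFlow.exists_tuned_of_normBound`).  This file redoes the (otherwise identical)
conversion with `pow_mul_rpow_le_inv_pow`, keeping the factor
`g₂ = κ^{L^d}·c₂·A^{−(η−1)}` (`c₂ = (2κ max(1,A_𝒫))^{c(d)L^d}2^{c(d)L^d}`, `η = 1 + (2(2^d+1)+6)^{−d}`),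
which tends to `0` as `A → ∞`:

* **`weakNormLE_nextKStep_sub_abkm_gain`** — `WeakNormLE P (k+1) (S(H,K) − S(H',K')) Θ_g` with
  `Θ_g = C_Δ(θ₀ + 2ε) + L^dκ^{L^d}[Σ₁-bracket]·A + 3(3Δ'+Δ_H+C_Δ)ωA⁴ + (2Δ'+C_Δ)·g₂`.

Everything is proved; no named fact.

## References
* S. Adams, S. Buchholz, R. Kotecký, S. Müller, arXiv:1910.13564, Theorem 6.8, Lemma 10.2, Ch. 12 (12.4)
  [AdamsBuchholzKoteckyMuller2019].
-/

noncomputable section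

namespace Literature.MathematicalPhysics.StatisticalMechanics.GradientRG

open scoped BigOperators Classical
open Finset MeasureTheory
open Literature.MathematicalPhysics.StatisticalMechanics.TorusPolymer
  (IsPolymer blocks polys bprod blockOf thicken reblock boxCorner mem_polys mem_blocks numBlocks isPolymer_blockOf
    card_blocks_eq_numBlocks blocks_blockOf empty_mem_polys closure)
open Literature.Barriers.CriticalPhenomena.LongRangePhi4.Polymer (IsConn components)
open Literature.MathematicalPhysics.StatisticalMechanics.GradientFRD (iterDiff)
open Literature.MathematicalPhysics.QuantumFieldTheory

variable {d M : ℕ} [NeZero M]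

set_option maxHeartbeats 400000 in
/-- **`‖S(H,K) − S(H',K')‖_{k+1}^{(A)} ≤ Θ_g`** (module docstring): the data of `tayNormLE_nextKStep_sub_abkm_raw`
plus `κ^{L^d}·c₃ ≤ A^{η−1}` and `κ^{L^d}·c₂ ≤ A^{η−1}`; the top term keeps the gain factor
`g₂ = κ^{L^d}c₂A^{−(η−1)}`. [cite: AdamsBuchholzKoteckyMuller2019, Theorem 6.8 / Ch. 12 (12.4)] -/
theorem weakNormLE_nextKStep_sub_abkm_gain {L N Mord R n p r₀ : ℕ} {θbar lam μ δ₁ δ₀ A𝒫 h A : ℝ}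
    {𝒞 : ℕ → (Fin d → ZMod M) → ℝ} (hd : 3 ≤ d) (hn : 2 ≤ n) (hLodd : Odd L) (hL : 2 ^ (d + 3) + 16 * R ≤ L)
    (hR2 : 2 ≤ R) (hM : M = L ^ N) {k : ℕ} (hkN : k + 1 ≤ N)
    (hp : d / 2 + 2 ≤ p) (hpM : p + d ≤ Mord) (hMR : Mord ≤ R) (hr₀ : 3 ≤ r₀)
    (hθbar : 0 < θbar) (hlam : 0 < lam)
    (hB : AbkmWeightBounds L N Mord R n θbar lam μ δ₁ δ₀ A𝒫 𝒞
      (abkmWeightData L N Mord R θbar (schedDelta δ₀ δ₁ N) 𝒞))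
    (hδ₀ : 0 < δ₀) (hδ₁ : 0 < δ₁) (hh : 0 < h) (hh0 : hZeroSq d R δ₀ δ₁ ≤ h ^ 2)
    {Cα : (Fin d → ℕ) → ℝ}
    (hCα : ∀ j, 1 ≤ j → j ≤ N + 1 → ∀ θ' : Fin d → ℕ, ∑ i, θ' i ≤ n →
      ∀ x, |iterDiff θ' (𝒞 j) x| ≤ Cα θ' / (L : ℝ) ^ ((j - 1) * (d - 2 + ∑ i, θ' i)))
    (hh2 : secondDiffConst Cα ≤ h ^ 2) (hA𝒫 : 0 ≤ A𝒫) (hA1 : 1 ≤ A)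
    (hA𝒫A : A𝒫 ≤ A)
    (hsmall : (2 : ℝ) ^ (L ^ d) * (A𝒫 * A ^ (-(1 - (1 + 1 / ((2 * (2 ^ d + 1) + 6 : ℝ) ^ d))⁻¹) : ℝ)) ≤ 1)
    (D : StepData d M) (hDs : D.s = L ^ k) (hDL : D.L = L) (hD𝒞 : D.𝒞 = 𝒞 (k + 1))
    {x₀ : Fin d → ZMod M} (hB₀ : D.B₀ = blockOf (L ^ k) x₀) (hc₀ : D.c₀ = boxCorner (L ^ k) (starRad R L d k) x₀)
    {H H' : RelevantHamiltonian ℂ d} {b : ℝ}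
    (hH : hamNorm (fieldWt h (L : ℝ) d k) ((L : ℝ) ^ k) (L ^ (d * k)) H ≤ b)
    (hH' : hamNorm (fieldWt h (L : ℝ) d k) ((L : ℝ) ^ k) (L ^ (d * k)) H' ≤ b) (hb : b ≤ 1 / 64)
    {K K' : Finset (Fin d → ZMod M) → ((Fin d → ZMod M) → ℝ) → ℂ} {C CΔ : ℝ} (hC : 0 ≤ C) (hCΔ : 0 ≤ CΔ)
    (hK : WeakNormLE (abkmNormParams L N Mord R p r₀ h θbar A (schedDelta δ₀ δ₁ N) 𝒞) k K C)
    (hK' : WeakNormLE (abkmNormParams L N Mord R p r₀ h θbar A (schedDelta δ₀ δ₁ N) 𝒞) k K' C)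
    (hΔ : WeakNormLE (abkmNormParams L N Mord R p r₀ h θbar A (schedDelta δ₀ δ₁ N) 𝒞) k (K - K') CΔ)
    (hKfac : Factorises (L ^ k) K) (hK0 : ∀ φ, K ∅ φ = 1) (hK'fac : Factorises (L ^ k) K') (hK'0 : ∀ φ, K' ∅ φ = 1)
    (hKd : ∀ Y, ContDiff ℝ r₀ (K Y)) (hK'd : ∀ Y, ContDiff ℝ r₀ (K' Y))
    (hKloc : ∀ Y, IsPolymer (L ^ k) Y → IsConn Y → IsGaugeLocal ((abkmNormParams L N Mord R p r₀ h θbar A (schedDelta δ₀ δ₁ N) 𝒞).gauge k Y) (K Y))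
    (hK'loc : ∀ Y, IsPolymer (L ^ k) Y → IsConn Y → IsGaugeLocal ((abkmNormParams L N Mord R p r₀ h θbar A (schedDelta δ₀ δ₁ N) 𝒞).gauge k Y) (K' Y))
    (hKt : TransInv (L ^ k) K) (hK't : TransInv (L ^ k) K')
    (hv : pi2BoundConst d (((2 * R + 2 : ℕ) : ℝ) + ((d / 2 + 1 : ℕ) : ℝ)) * (C * A𝒫 * A⁻¹) ≤ 1 / 64)
    {ω : ℝ}
    (hω1 : 8 * Real.exp (1 / 4) * (2 * b + pi2BoundConst d (((2 * R + 2 : ℕ) : ℝ) + ((d / 2 + 1 : ℕ) : ℝ)) * (C * A𝒫 * A⁻¹)) + 16 * Real.exp (3 / 8) * (2 * hamNorm (fieldWt h (L : ℝ) d k) ((L : ℝ) ^ k) (L ^ (d * k)) (H - H') + pi2BoundConst d (((2 * R + 2 : ℕ) : ℝ) + ((d / 2 + 1 : ℕ) : ℝ)) * (CΔ * A𝒫 * A⁻¹)) ≤ ω)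
    (hω2 : 8 * Real.exp (1 / 4) * b + 16 * Real.exp (3 / 8) * hamNorm (fieldWt h (L : ℝ) d k) ((L : ℝ) ^ k) (L ^ (d * k)) (H - H') ≤ ω)
    (hω3 : C + CΔ ≤ ω) (hωA : ω * A ^ 2 ≤ 1)
    {κ : ℝ}
    (hκ1 : 1 + Real.exp (1 / 4) + 16 * Real.exp (3 / 8) * (2 * hamNorm (fieldWt h (L : ℝ) d k) ((L : ℝ) ^ k) (L ^ (d * k)) (H - H') + pi2BoundConst d (((2 * R + 2 : ℕ) : ℝ) + ((d / 2 + 1 : ℕ) : ℝ)) * (CΔ * A𝒫 * A⁻¹)) ≤ κ)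
    (hκ2 : 1 + Real.exp (1 / 4) + 16 * Real.exp (3 / 8) * (2 * b + pi2BoundConst d (((2 * R + 2 : ℕ) : ℝ) + ((d / 2 + 1 : ℕ) : ℝ)) * (C * A𝒫 * A⁻¹)) ≤ κ)
    (hc3A : κ ^ (L ^ d) * ((2 * (2 * κ * max 1 A𝒫)) ^ ((2 ^ (d + 1) + 2) ^ d * L ^ d) * (4 : ℝ) ^ ((2 ^ (d + 1) + 2) ^ d * L ^ d)) ≤ A ^ ((1 + 1 / ((2 * (2 ^ d + 1) + 6 : ℝ) ^ d)) - 1 : ℝ))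
    (hc2A : κ ^ (L ^ d) * ((2 * κ * max 1 A𝒫) ^ ((2 ^ (d + 1) + 2) ^ d * L ^ d) * (2 : ℝ) ^ ((2 ^ (d + 1) + 2) ^ d * L ^ d)) ≤ A ^ ((1 + 1 / ((2 * (2 ^ d + 1) + 6 : ℝ) ^ d)) - 1 : ℝ)) :
    WeakNormLE (abkmNormParams L N Mord R p r₀ h θbar A (schedDelta δ₀ δ₁ N) 𝒞) (k + 1) (fun U φ => nextKStep D H K U φ - nextKStep D H' K' U φ)
      (CΔ * ((L : ℝ) ^ d * (A𝒫 * abkmContrConst d L R) + largePartEps d L A A𝒫 (1 + 1 / ((2 * (2 ^ d + 1) + 6 : ℝ) ^ d)) + largePartEps d L A A𝒫 (1 + 1 / ((2 * (2 ^ d + 1) + 6 : ℝ) ^ d))) +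
        ((L ^ d : ℕ) : ℝ) * κ ^ (L ^ d) * ((16 * Real.exp (3 / 8) * (2 * hamNorm (fieldWt h (L : ℝ) d k) ((L : ℝ) ^ k) (L ^ (d * k)) (H - H') + pi2BoundConst d (((2 * R + 2 : ℕ) : ℝ) + ((d / 2 + 1 : ℕ) : ℝ)) * (CΔ * A𝒫 * A⁻¹))) * (((1 + 8 * pi2BoundConst d (((2 * R + 2 : ℕ) : ℝ) + ((d / 2 + 1 : ℕ) : ℝ))) * (C * A𝒫 * A⁻¹)) + 256 * Real.exp (1 / 4) * ((A𝒫 + 4) * b ^ 2 + 2 * b * (pi2BoundConst d (((2 * R + 2 : ℕ) : ℝ) + ((d / 2 + 1 : ℕ) : ℝ)) * (C * A𝒫 * A⁻¹)) + (pi2BoundConst d (((2 * R + 2 : ℕ) : ℝ) + ((d / 2 + 1 : ℕ) : ℝ)) * (C * A𝒫 * A⁻¹)) ^ 2)) + 16 * Real.exp (3 / 8) * (2 * b + pi2BoundConst d (((2 * R + 2 : ℕ) : ℝ) + ((d / 2 + 1 : ℕ) : ℝ)) * (C * A𝒫 * A⁻¹)) * ((1 + 8 * pi2BoundConst d (((2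 * R + 2 : ℕ) : ℝ) + ((d / 2 + 1 : ℕ) : ℝ))) * (CΔ * A𝒫 * A⁻¹)) + (512 * Real.exp (1 / 4) * (A𝒫 + 4) * (b + b) * hamNorm (fieldWt h (L : ℝ) d k) ((L : ℝ) ^ k) (L ^ (d * k)) (H - H') + 512 * Real.exp (1 / 4) * (hamNorm (fieldWt h (L : ℝ) d k) ((L : ℝ) ^ k) (L ^ (d * k)) (H - H') * (pi2BoundConst d (((2 * R + 2 : ℕ) : ℝ) + ((d / 2 + 1 : ℕ) : ℝ)) * (C * A𝒫 * A⁻¹)) + b * (pi2BoundConst d (((2 * R + 2 : ℕ) : ℝ) + ((d / 2 + 1 : ℕ) : ℝ)) * (CΔ * A𝒫 * A⁻¹))) + 256 * Real.exp (1 / 4) * (pi2BoundConst d (((2 * R + 2 : ℕ) : ℝ) + ((d / 2 + 1 : ℕ) : ℝ)) * (C * A𝒫 * A⁻¹) + pi2BoundConst d (((2 * R + 2 : ℕ) : ℝ) + ((d / 2 + 1 : ℕ) : ℝ)) * (CΔ * A𝒫 * A⁻¹)) * (pi2BoundConst d (((2 * R + 2 : ℕ) : ℝ) + ((d / 2 +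 1 : ℕ) : ℝ)) * (CΔ * A𝒫 * A⁻¹)))) * A +
        (((3 * (16 * Real.exp (3 / 8) * (2 * hamNorm (fieldWt h (L : ℝ) d k) ((L : ℝ) ^ k) (L ^ (d * k)) (H - H') + pi2BoundConst d (((2 * R + 2 : ℕ) : ℝ) + ((d / 2 + 1 : ℕ) : ℝ)) * (CΔ * A𝒫 * A⁻¹))) + 16 * Real.exp (3 / 8) * hamNorm (fieldWt h (L : ℝ) d k) ((L : ℝ) ^ k) (L ^ (d * k)) (H - H') + CΔ) * (ω * A ^ 4)) + (2 * (16 * Real.exp (3 / 8) * (2 * hamNorm (fieldWt h (L : ℝ) d k) ((L : ℝ) ^ k) (L ^ (d * k)) (H - H') + pi2BoundConst d (((2 * R + 2 : ℕ) : ℝ) + ((d / 2 + 1 : ℕ) : ℝ)) * (CΔ * A𝒫 * A⁻¹))) + CΔ) * (κ ^ (L ^ d) * ((2 * κ * max 1 A𝒫) ^ ((2 ^ (d + 1) + 2) ^ d * L ^ d) * (2 : ℝ) ^ ((2 ^ (d + 1) + 2) ^ d * L ^ d)) * A ^ (-((1 + 1 / ((2 * (2 ^ d + 1) + 6 : ℝ)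 ^ d)) - 1) : ℝ))) + ((3 * (16 * Real.exp (3 / 8) * (2 * hamNorm (fieldWt h (L : ℝ) d k) ((L : ℝ) ^ k) (L ^ (d * k)) (H - H') + pi2BoundConst d (((2 * R + 2 : ℕ) : ℝ) + ((d / 2 + 1 : ℕ) : ℝ)) * (CΔ * A𝒫 * A⁻¹))) + 16 * Real.exp (3 / 8) * hamNorm (fieldWt h (L : ℝ) d k) ((L : ℝ) ^ k) (L ^ (d * k)) (H - H') + CΔ) * (ω * A ^ 4)) + ((3 * (16 * Real.exp (3 / 8) * (2 * hamNorm (fieldWt h (L : ℝ) d k) ((L : ℝ) ^ k) (L ^ (d * k)) (H - H') + pi2BoundConst d (((2 * R + 2 : ℕ) : ℝ) + ((d / 2 + 1 : ℕ) : ℝ)) * (CΔ * A𝒫 * A⁻¹))) + 16 * Real.exp (3 / 8) * hamNorm (fieldWt h (L : ℝ) d k) ((L : ℝ) ^ k) (L ^ (d * k)) (H - H') + CΔ) * (ω * A ^ 4))) := by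
  intro U hU hUc
  have hU' : IsPolymer (L ^ (k + 1)) U := hU
  have hraw := tayNormLE_nextKStep_sub_abkm_raw hd hn hLodd hL hR2 hM hkN hp hpM hMR hr₀ hθbar hlam hB hδ₀ hδ₁ hh hh0 hCα
    hh2 hA𝒫 hA1 hA𝒫A hsmall D hDs hDL hD𝒞 hB₀ hc₀ hU' hUc hH hH' hb hC hCΔ hK hK' hΔ hKfac hK0 hK'fac hK'0 hKd hK'd hKloc
    hK'loc hKt hK't hv hω1 hω2 hω3 hωA hκ1 hκ2
  refine hraw.mono ?_ fun φ => ((abkmWeightData L N Mord R θbar (schedDelta δ₀ δ₁ N) 𝒞).weight_pos (k + 1) U φ).le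
  -- sizes
  have hd2 : 2 ≤ d := by omega
  have hpR : p ≤ R := by omega
  have hL0 : (0 : ℝ) < L := by exact_mod_cast hLodd.pos
  have hA0 : 0 < A := by linarith
  have hsodd : Odd (L ^ k) := hLodd.pow
  have h𝔥 : 0 < fieldWt h (L : ℝ) d k := fieldWt_pos hh hL0 d k
  have hRk : (0 : ℝ) < (L : ℝ) ^ k := by positivity
  have hnn : ∀ G : RelevantHamiltonian ℂ d, 0 ≤ hamNorm (fieldWt h (L : ℝ) d k) ((L : ℝ) ^ k) (L ^ (d * k)) G :=
    fun G => hamNorm_nonneg h𝔥.le hRk.le _ _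
  have hnHH0 := hnn (H - H')
  have hb0 : 0 ≤ b := (hnn H).trans hH
  have hC87_0 : 0 ≤ pi2BoundConst d (((2 * R + 2 : ℕ) : ℝ) + ((d / 2 + 1 : ℕ) : ℝ)) := pi2BoundConst_nonneg d (by positivity)
  have hAinv : 0 ≤ A⁻¹ := inv_nonneg.2 hA0.le
  have hvΔ0 : 0 ≤ pi2BoundConst d (((2 * R + 2 : ℕ) : ℝ) + ((d / 2 + 1 : ℕ) : ℝ)) * (CΔ * A𝒫 * A⁻¹) := by positivity
  have he38 : 0 ≤ 16 * Real.exp (3 / 8) := by positivity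
  have hDP0 : 0 ≤ 16 * Real.exp (3 / 8) * (2 * hamNorm (fieldWt h (L : ℝ) d k) ((L : ℝ) ^ k) (L ^ (d * k)) (H - H') + pi2BoundConst d (((2 * R + 2 : ℕ) : ℝ) + ((d / 2 + 1 : ℕ) : ℝ)) * (CΔ * A𝒫 * A⁻¹)) := by positivity
  have hDH0 : 0 ≤ 16 * Real.exp (3 / 8) * hamNorm (fieldWt h (L : ℝ) d k) ((L : ℝ) ^ k) (L ^ (d * k)) (H - H') := by positivity
  have hω0 : 0 ≤ ω := le_trans (by positivity) hω3
  have hX34 : 0 ≤ ((3 * (16 * Real.exp (3 / 8) * (2 * hamNorm (fieldWt h (L : ℝ) d k) ((L : ℝ) ^ k) (L ^ (d * k)) (H - H') + pi2BoundConst d (((2 * R + 2 : ℕ) : ℝ) + ((d / 2 + 1 : ℕ) : ℝ)) * (CΔ * A𝒫 * A⁻¹))) + 16 * Real.exp (3 / 8) * hamNorm (fieldWt h (L : ℝ) d k) ((L : ℝ) ^ k) (L ^ (d * k)) (H - H') + CΔ) * (ω * A ^ 4)) := by positivity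
  have hX2B : 0 ≤ (2 * (16 * Real.exp (3 / 8) * (2 * hamNorm (fieldWt h (L : ℝ) d k) ((L : ℝ) ^ k) (L ^ (d * k)) (H - H') + pi2BoundConst d (((2 * R + 2 : ℕ) : ℝ) + ((d / 2 + 1 : ℕ) : ℝ)) * (CΔ * A𝒫 * A⁻¹))) + CΔ) := by positivity
  have hκ0 : 0 ≤ κ := by
    have e1 : 0 ≤ 16 * Real.exp (3 / 8) * (2 * hamNorm (fieldWt h (L : ℝ) d k) ((L : ℝ) ^ k) (L ^ (d * k)) (H - H') + pi2BoundConst d (((2 * R + 2 : ℕ) : ℝ) + ((d / 2 + 1 : ℕ) : ℝ)) * (CΔ * A𝒫 * A⁻¹)) := hDP0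
    linarith [hκ1, Real.exp_pos (1 / 4)]
  have hmax : 0 ≤ 2 * κ * max 1 A𝒫 := by positivity
  have hc3 : 0 ≤ κ ^ (L ^ d) * ((2 * (2 * κ * max 1 A𝒫)) ^ ((2 ^ (d + 1) + 2) ^ d * L ^ d) * (4 : ℝ) ^ ((2 ^ (d + 1) + 2) ^ d * L ^ d)) := by positivity
  have hc2 : 0 ≤ κ ^ (L ^ d) * ((2 * κ * max 1 A𝒫) ^ ((2 ^ (d + 1) + 2) ^ d * L ^ d) * (2 : ℝ) ^ ((2 ^ (d + 1) + 2) ^ d * L ^ d)) := by positivity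
  -- block counts: `|U|_k = L^d |U|_{k+1}`, `|U|_{k+1} ≥ 1`
  have hMeq : M = L * L ^ k * L ^ (N - k - 1) := by
    rw [hM, ← pow_succ', ← pow_add]; congr 1; omega
  have hUm : IsPolymer (L * L ^ k) U := by rw [← pow_succ']; exact hU'
  have hm0 : (blocks (L ^ k) U).card = L ^ d * (blocks (L * L ^ k) U).card :=
    TorusPolymer.card_blocks_eq_mul hMeq hsodd hLodd hLodd.pow hUm
  have hm1 : 1 ≤ (blocks (L * L ^ k) U).card := by
    obtain ⟨u, hu⟩ := hUc.1
    exact card_pos.2 ⟨blockOf (L * L ^ k) u, mem_blocks.2 ⟨u, hu, rfl⟩⟩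
  have haF : (abkmNormParams L N Mord R p r₀ h θbar A (schedDelta δ₀ δ₁ N) 𝒞).aFactor (k + 1) U = (A ^ (blocks (L * L ^ k) U).card)⁻¹ := by
    show (A ^ numBlocks (L ^ (k + 1)) U)⁻¹ = _
    rw [← card_blocks_eq_numBlocks, pow_succ']
  -- absorbing `κ^{|U|_k} c^{|U|_{k+1}}` by the gain
  have hg3 : κ ^ (blocks (L ^ k) U).card * (((2 * (2 * κ * max 1 A𝒫)) ^ ((2 ^ (d + 1) + 2) ^ d * L ^ d) * (4 : ℝ) ^ ((2 ^ (d + 1) + 2) ^ d * L ^ d)) ^ (blocks (L * L ^ k) U).card * A ^ (-((1 + 1 / ((2 * (2 ^ d + 1) + 6 : ℝ) ^ d)) * (blocks (L * L ^ k) U).card) : ℝ)) ≤ (A ^ (blocks (L * L ^ k) U).card)⁻¹ := by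
    rw [hm0, pow_mul, ← mul_assoc, ← mul_pow]
    exact TorusPolymer.pow_mul_rpow_le_inv_pow' hA1 hc3 hc3A hm1
  have hg2 : κ ^ (blocks (L ^ k) U).card * (((2 * κ * max 1 A𝒫) ^ ((2 ^ (d + 1) + 2) ^ d * L ^ d) * (2 : ℝ) ^ ((2 ^ (d + 1) + 2) ^ d * L ^ d)) ^ (blocks (L * L ^ k) U).card * A ^ (-((1 + 1 / ((2 * (2 ^ d + 1) + 6 : ℝ) ^ d)) * (blocks (L * L ^ k) U).card) : ℝ)) ≤ (κ ^ (L ^ d) * ((2 * κ * max 1 A𝒫) ^ ((2 ^ (d + 1) + 2) ^ d * L ^ d) * (2 : ℝ) ^ ((2 ^ (d + 1) + 2) ^ d * L ^ d)) * A ^ (-((1 + 1 / ((2 * (2 ^ d + 1) + 6 : ℝ) ^ d)) - 1) : ℝ)) * (A ^ (blocks (L * L ^ k) U).card)⁻¹ := by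
    rw [hm0, pow_mul, ← mul_assoc, ← mul_pow]
    exact TorusPolymer.pow_mul_rpow_le_inv_pow hA1 hc2 hc2A hm1
  have e34 : κ ^ (blocks (L ^ k) U).card * ((3 * (16 * Real.exp (3 / 8) * (2 * hamNorm (fieldWt h (L : ℝ) d k) ((L : ℝ) ^ k) (L ^ (d * k)) (H - H') + pi2BoundConst d (((2 * R + 2 : ℕ) : ℝ) + ((d / 2 + 1 : ℕ) : ℝ)) * (CΔ * A𝒫 * A⁻¹))) + 16 * Real.exp (3 / 8) * hamNorm (fieldWt h (L : ℝ) d k) ((L : ℝ) ^ k) (L ^ (d * k)) (H - H') + CΔ) * (ω * A ^ 4)) * (((2 * (2 * κ * max 1 A𝒫)) ^ ((2 ^ (d + 1) + 2) ^ d * L ^ d) * (4 : ℝ) ^ ((2 ^ (d + 1) + 2) ^ d * L ^ d)) ^ (blocks (L * L ^ k) U).card * A ^ (-((1 + 1 / ((2 * (2 ^ d + 1) + 6 : ℝ) ^ d)) * (blocks (L * L ^ k) U).card) : ℝ)) ≤ ((3 * (16 * Real.exp (3 / 8) * (2 * hamNorm (fieldWt h (L : ℝ) d k) ((L : ℝ)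 ^ k) (L ^ (d * k)) (H - H') + pi2BoundConst d (((2 * R + 2 : ℕ) : ℝ) + ((d / 2 + 1 : ℕ) : ℝ)) * (CΔ * A𝒫 * A⁻¹))) + 16 * Real.exp (3 / 8) * hamNorm (fieldWt h (L : ℝ) d k) ((L : ℝ) ^ k) (L ^ (d * k)) (H - H') + CΔ) * (ω * A ^ 4)) * (A ^ (blocks (L * L ^ k) U).card)⁻¹ := by
    calc κ ^ (blocks (L ^ k) U).card * ((3 * (16 * Real.exp (3 / 8) * (2 * hamNorm (fieldWt h (L : ℝ) d k) ((L : ℝ) ^ k) (L ^ (d * k)) (H - H') + pi2BoundConst d (((2 * R + 2 : ℕ) : ℝ) + ((d / 2 + 1 : ℕ) : ℝ)) * (CΔ * A𝒫 * A⁻¹))) + 16 * Real.exp (3 / 8) * hamNorm (fieldWt h (L : ℝ) d k) ((L : ℝ) ^ k) (L ^ (d * k)) (H - H') + CΔ) * (ω * A ^ 4)) * (((2 * (2 * κ * max 1 A𝒫)) ^ ((2 ^ (d + 1) + 2) ^ d * L ^ d) * (4 : ℝ) ^ ((2 ^ (d + 1) + 2) ^ d * L ^ d)) ^ (blocks (L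 * L ^ k) U).card * A ^ (-((1 + 1 / ((2 * (2 ^ d + 1) + 6 : ℝ) ^ d)) * (blocks (L * L ^ k) U).card) : ℝ))
        = ((3 * (16 * Real.exp (3 / 8) * (2 * hamNorm (fieldWt h (L : ℝ) d k) ((L : ℝ) ^ k) (L ^ (d * k)) (H - H') + pi2BoundConst d (((2 * R + 2 : ℕ) : ℝ) + ((d / 2 + 1 : ℕ) : ℝ)) * (CΔ * A𝒫 * A⁻¹))) + 16 * Real.exp (3 / 8) * hamNorm (fieldWt h (L : ℝ) d k) ((L : ℝ) ^ k) (L ^ (d * k)) (H - H') + CΔ) * (ω * A ^ 4)) * (κ ^ (blocks (L ^ k) U).card * (((2 * (2 * κ * max 1 A𝒫)) ^ ((2 ^ (d + 1) + 2) ^ d * L ^ d) * (4 : ℝ) ^ ((2 ^ (d + 1) + 2) ^ d * L ^ d)) ^ (blocks (L * L ^ k) U).card * A ^ (-((1 + 1 / ((2 * (2 ^ d + 1) + 6 : ℝ) ^ d)) * (blocks (L * L ^ k) U).card) : ℝ))) := by ring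
      _ ≤ ((3 * (16 * Real.exp (3 / 8) * (2 * hamNorm (fieldWt h (L : ℝ) d k) ((L : ℝ) ^ k) (L ^ (d * k)) (H - H') + pi2BoundConst d (((2 * R + 2 : ℕ) : ℝ) + ((d / 2 + 1 : ℕ) : ℝ)) * (CΔ * A𝒫 * A⁻¹))) + 16 * Real.exp (3 / 8) * hamNorm (fieldWt h (L : ℝ) d k) ((L : ℝ) ^ k) (L ^ (d * k)) (H - H') + CΔ) * (ω * A ^ 4)) * (A ^ (blocks (L * L ^ k) U).card)⁻¹ := mul_le_mul_of_nonneg_left hg3 hX34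
  have e2B : κ ^ (blocks (L ^ k) U).card * (2 * (16 * Real.exp (3 / 8) * (2 * hamNorm (fieldWt h (L : ℝ) d k) ((L : ℝ) ^ k) (L ^ (d * k)) (H - H') + pi2BoundConst d (((2 * R + 2 : ℕ) : ℝ) + ((d / 2 + 1 : ℕ) : ℝ)) * (CΔ * A𝒫 * A⁻¹))) + CΔ) * (((2 * κ * max 1 A𝒫) ^ ((2 ^ (d + 1) + 2) ^ d * L ^ d) * (2 : ℝ) ^ ((2 ^ (d + 1) + 2) ^ d * L ^ d)) ^ (blocks (L * L ^ k) U).card * A ^ (-((1 + 1 / ((2 * (2 ^ d + 1) + 6 : ℝ) ^ d)) * (blocks (L * L ^ k) U).card) : ℝ)) ≤ (2 * (16 * Real.exp (3 / 8) * (2 * hamNorm (fieldWt h (L : ℝ) d k) ((L : ℝ) ^ k) (L ^ (d * k)) (H - H') + pi2BoundConst d (((2 * R + 2 : ℕ) : ℝ) + ((d / 2 + 1 : ℕ) : ℝ)) * (CΔ * A𝒫 * A⁻¹))) + CΔ) * (κ ^ (L ^ d) * ((2 * κ * max 1 A𝒫) ^ ((2 ^ (d + 1) + 2) ^ d * L ^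 d) * (2 : ℝ) ^ ((2 ^ (d + 1) + 2) ^ d * L ^ d)) * A ^ (-((1 + 1 / ((2 * (2 ^ d + 1) + 6 : ℝ) ^ d)) - 1) : ℝ)) * (A ^ (blocks (L * L ^ k) U).card)⁻¹ := by
    calc κ ^ (blocks (L ^ k) U).card * (2 * (16 * Real.exp (3 / 8) * (2 * hamNorm (fieldWt h (L : ℝ) d k) ((L : ℝ) ^ k) (L ^ (d * k)) (H - H') + pi2BoundConst d (((2 * R + 2 : ℕ) : ℝ) + ((d / 2 + 1 : ℕ) : ℝ)) * (CΔ * A𝒫 * A⁻¹))) + CΔ) * (((2 * κ * max 1 A𝒫) ^ ((2 ^ (d + 1) + 2) ^ d * L ^ d) * (2 : ℝ) ^ ((2 ^ (d + 1) + 2) ^ d * L ^ d)) ^ (blocks (L * L ^ k) U).card * A ^ (-((1 + 1 / ((2 * (2 ^ d + 1) + 6 : ℝ) ^ d)) * (blocks (L * L ^ k) U).card) : ℝ))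
        = (2 * (16 * Real.exp (3 / 8) * (2 * hamNorm (fieldWt h (L : ℝ) d k) ((L : ℝ) ^ k) (L ^ (d * k)) (H - H') + pi2BoundConst d (((2 * R + 2 : ℕ) : ℝ) + ((d / 2 + 1 : ℕ) : ℝ)) * (CΔ * A𝒫 * A⁻¹))) + CΔ) * (κ ^ (blocks (L ^ k) U).card * (((2 * κ * max 1 A𝒫) ^ ((2 ^ (d + 1) + 2) ^ d * L ^ d) * (2 : ℝ) ^ ((2 ^ (d + 1) + 2) ^ d * L ^ d)) ^ (blocks (L * L ^ k) U).card * A ^ (-((1 + 1 / ((2 * (2 ^ d + 1) + 6 : ℝ) ^ d)) * (blocks (L * L ^ k) U).card) : ℝ))) := by ring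
      _ ≤ (2 * (16 * Real.exp (3 / 8) * (2 * hamNorm (fieldWt h (L : ℝ) d k) ((L : ℝ) ^ k) (L ^ (d * k)) (H - H') + pi2BoundConst d (((2 * R + 2 : ℕ) : ℝ) + ((d / 2 + 1 : ℕ) : ℝ)) * (CΔ * A𝒫 * A⁻¹))) + CΔ) * ((κ ^ (L ^ d) * ((2 * κ * max 1 A𝒫) ^ ((2 ^ (d + 1) + 2) ^ d * L ^ d) * (2 : ℝ) ^ ((2 ^ (d + 1) + 2) ^ d * L ^ d)) * A ^ (-((1 + 1 / ((2 * (2 ^ d + 1) + 6 : ℝ) ^ d)) - 1) : ℝ)) * (A ^ (blocks (L * L ^ k) U).card)⁻¹) := mul_le_mul_of_nonneg_left hg2 hX2B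
      _ = (2 * (16 * Real.exp (3 / 8) * (2 * hamNorm (fieldWt h (L : ℝ) d k) ((L : ℝ) ^ k) (L ^ (d * k)) (H - H') + pi2BoundConst d (((2 * R + 2 : ℕ) : ℝ) + ((d / 2 + 1 : ℕ) : ℝ)) * (CΔ * A𝒫 * A⁻¹))) + CΔ) * (κ ^ (L ^ d) * ((2 * κ * max 1 A𝒫) ^ ((2 ^ (d + 1) + 2) ^ d * L ^ d) * (2 : ℝ) ^ ((2 ^ (d + 1) + 2) ^ d * L ^ d)) * A ^ (-((1 + 1 / ((2 * (2 ^ d + 1) + 6 : ℝ) ^ d)) - 1) : ℝ)) * (A ^ (blocks (L * L ^ k) U).card)⁻¹ := by ring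
  rw [haF]
  have hfin : CΔ * ((L : ℝ) ^ d * (A𝒫 * abkmContrConst d L R) + largePartEps d L A A𝒫 (1 + 1 / ((2 * (2 ^ d + 1) + 6 : ℝ) ^ d)) + largePartEps d L A A𝒫 (1 + 1 / ((2 * (2 ^ d + 1) + 6 : ℝ) ^ d))) * (A ^ (blocks (L * L ^ k) U).card)⁻¹ +
        ((L ^ d : ℕ) : ℝ) * κ ^ (L ^ d) * ((16 * Real.exp (3 / 8) * (2 * hamNorm (fieldWt h (L : ℝ) d k) ((L : ℝ) ^ k) (L ^ (d * k)) (H - H') + pi2BoundConst d (((2 * R + 2 : ℕ) : ℝ) + ((d / 2 + 1 : ℕ) : ℝ)) * (CΔ * A𝒫 * A⁻¹))) * (((1 + 8 * pi2BoundConst d (((2 * R + 2 : ℕ) : ℝ) + ((d / 2 + 1 : ℕ) : ℝ))) * (C * A𝒫 * A⁻¹)) + 256 * Real.exp (1 / 4) * ((A𝒫 + 4) * b ^ 2 + 2 * b * (pi2BoundConst d (((2 * R + 2 : ℕ) : ℝ) + ((d / 2 + 1 : ℕ) : ℝ)) * (C * A𝒫 * A⁻¹)) + (pi2BoundConst d (((2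 * R + 2 : ℕ) : ℝ) + ((d / 2 + 1 : ℕ) : ℝ)) * (C * A𝒫 * A⁻¹)) ^ 2)) + 16 * Real.exp (3 / 8) * (2 * b + pi2BoundConst d (((2 * R + 2 : ℕ) : ℝ) + ((d / 2 + 1 : ℕ) : ℝ)) * (C * A𝒫 * A⁻¹)) * ((1 + 8 * pi2BoundConst d (((2 * R + 2 : ℕ) : ℝ) + ((d / 2 + 1 : ℕ) : ℝ))) * (CΔ * A𝒫 * A⁻¹)) + (512 * Real.exp (1 / 4) * (A𝒫 + 4) * (b + b) * hamNorm (fieldWt h (L : ℝ) d k) ((L : ℝ) ^ k) (L ^ (d * k)) (H - H') + 512 * Real.exp (1 / 4) * (hamNorm (fieldWt h (L : ℝ) d k) ((L : ℝ) ^ k) (L ^ (d * k)) (H - H') * (pi2BoundConst d (((2 * R + 2 : ℕ) : ℝ) + ((d / 2 + 1 : ℕ) : ℝ)) * (C * A𝒫 * A⁻¹)) + b * (pi2BoundConst d (((2 * R + 2 : ℕ) : ℝ) + ((d / 2 + 1 : ℕ) : ℝ)) * (CΔ * A𝒫 * A⁻¹))) + 256 * Real.exp (1 / 4) * (pi2BoundConst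 d (((2 * R + 2 : ℕ) : ℝ) + ((d / 2 + 1 : ℕ) : ℝ)) * (C * A𝒫 * A⁻¹) + pi2BoundConst d (((2 * R + 2 : ℕ) : ℝ) + ((d / 2 + 1 : ℕ) : ℝ)) * (CΔ * A𝒫 * A⁻¹)) * (pi2BoundConst d (((2 * R + 2 : ℕ) : ℝ) + ((d / 2 + 1 : ℕ) : ℝ)) * (CΔ * A𝒫 * A⁻¹)))) * (A * (A ^ (blocks (L * L ^ k) U).card)⁻¹) +
        (((3 * (16 * Real.exp (3 / 8) * (2 * hamNorm (fieldWt h (L : ℝ) d k) ((L : ℝ) ^ k) (L ^ (d * k)) (H - H') + pi2BoundConst d (((2 * R + 2 : ℕ) : ℝ) + ((d / 2 + 1 : ℕ) : ℝ)) * (CΔ * A𝒫 * A⁻¹))) + 16 * Real.exp (3 / 8) * hamNorm (fieldWt h (L : ℝ) d k) ((L : ℝ) ^ k) (L ^ (d * k)) (H - H') + CΔ) * (ω * A ^ 4)) * (A ^ (blocks (L * L ^ k) U).card)⁻¹ + (2 * (16 * Real.exp (3 / 8) * (2 * hamNorm (fieldWt h (L : ℝ) d k) ((L : ℝ) ^ k)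 (L ^ (d * k)) (H - H') + pi2BoundConst d (((2 * R + 2 : ℕ) : ℝ) + ((d / 2 + 1 : ℕ) : ℝ)) * (CΔ * A𝒫 * A⁻¹))) + CΔ) * (κ ^ (L ^ d) * ((2 * κ * max 1 A𝒫) ^ ((2 ^ (d + 1) + 2) ^ d * L ^ d) * (2 : ℝ) ^ ((2 ^ (d + 1) + 2) ^ d * L ^ d)) * A ^ (-((1 + 1 / ((2 * (2 ^ d + 1) + 6 : ℝ) ^ d)) - 1) : ℝ)) * (A ^ (blocks (L * L ^ k) U).card)⁻¹) +
        ((3 * (16 * Real.exp (3 / 8) * (2 * hamNorm (fieldWt h (L : ℝ) d k) ((L : ℝ) ^ k) (L ^ (d * k)) (H - H') + pi2BoundConst d (((2 * R + 2 : ℕ) : ℝ) + ((d / 2 + 1 : ℕ) : ℝ)) * (CΔ * A𝒫 * A⁻¹))) + 16 * Real.exp (3 / 8) * hamNorm (fieldWt h (L : ℝ) d k) ((L : ℝ) ^ k) (L ^ (d * k)) (H - H') + CΔ) * (ω * A ^ 4)) * (A ^ (blocks (L * L ^ k) U).card)⁻¹ + ((3 * (16 * Real.exp (3 / 8) * (2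 * hamNorm (fieldWt h (L : ℝ) d k) ((L : ℝ) ^ k) (L ^ (d * k)) (H - H') + pi2BoundConst d (((2 * R + 2 : ℕ) : ℝ) + ((d / 2 + 1 : ℕ) : ℝ)) * (CΔ * A𝒫 * A⁻¹))) + 16 * Real.exp (3 / 8) * hamNorm (fieldWt h (L : ℝ) d k) ((L : ℝ) ^ k) (L ^ (d * k)) (H - H') + CΔ) * (ω * A ^ 4)) * (A ^ (blocks (L * L ^ k) U).card)⁻¹ =
      (CΔ * ((L : ℝ) ^ d * (A𝒫 * abkmContrConst d L R) + largePartEps d L A A𝒫 (1 + 1 / ((2 * (2 ^ d + 1) + 6 : ℝ) ^ d)) + largePartEps d L A A𝒫 (1 + 1 / ((2 * (2 ^ d + 1) + 6 : ℝ) ^ d))) +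
        ((L ^ d : ℕ) : ℝ) * κ ^ (L ^ d) * ((16 * Real.exp (3 / 8) * (2 * hamNorm (fieldWt h (L : ℝ) d k) ((L : ℝ) ^ k) (L ^ (d * k)) (H - H') + pi2BoundConst d (((2 * R + 2 : ℕ) : ℝ) + ((d / 2 + 1 : ℕ) : ℝ)) * (CΔ * A𝒫 * A⁻¹))) * (((1 + 8 * pi2BoundConst d (((2 * R + 2 : ℕ) : ℝ) + ((d / 2 + 1 : ℕ) : ℝ))) * (C * A𝒫 * A⁻¹)) + 256 * Real.exp (1 / 4) * ((A𝒫 + 4) * b ^ 2 + 2 * b * (pi2BoundConst d (((2 * R + 2 : ℕ) : ℝ) + ((d / 2 + 1 : ℕ) : ℝ)) * (C * A𝒫 * A⁻¹)) + (pi2BoundConst d (((2 * R + 2 : ℕ) : ℝ) + ((d / 2 + 1 : ℕ) : ℝ)) * (C * A𝒫 * A⁻¹)) ^ 2)) + 16 * Real.exp (3 / 8) * (2 * b + pi2BoundConst d (((2 * R + 2 : ℕ) : ℝ) + ((d / 2 + 1 : ℕ) : ℝ)) * (C * A𝒫 * A⁻¹)) * ((1 + 8 * pi2BoundConst d (((2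 * R + 2 : ℕ) : ℝ) + ((d / 2 + 1 : ℕ) : ℝ))) * (CΔ * A𝒫 * A⁻¹)) + (512 * Real.exp (1 / 4) * (A𝒫 + 4) * (b + b) * hamNorm (fieldWt h (L : ℝ) d k) ((L : ℝ) ^ k) (L ^ (d * k)) (H - H') + 512 * Real.exp (1 / 4) * (hamNorm (fieldWt h (L : ℝ) d k) ((L : ℝ) ^ k) (L ^ (d * k)) (H - H') * (pi2BoundConst d (((2 * R + 2 : ℕ) : ℝ) + ((d / 2 + 1 : ℕ) : ℝ)) * (C * A𝒫 * A⁻¹)) + b * (pi2BoundConst d (((2 * R + 2 : ℕ) : ℝ) + ((d / 2 + 1 : ℕ) : ℝ)) * (CΔ * A𝒫 * A⁻¹))) + 256 * Real.exp (1 / 4) * (pi2BoundConst d (((2 * R + 2 : ℕ) : ℝ) + ((d / 2 + 1 : ℕ) : ℝ)) * (C * A𝒫 * A⁻¹) + pi2BoundConst d (((2 * R + 2 : ℕ) : ℝ) + ((d / 2 + 1 : ℕ) : ℝ)) * (CΔ * A𝒫 * A⁻¹)) * (pi2BoundConst d (((2 * R + 2 : ℕ) : ℝ) + ((d / 2 +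 1 : ℕ) : ℝ)) * (CΔ * A𝒫 * A⁻¹)))) * A +
        (((3 * (16 * Real.exp (3 / 8) * (2 * hamNorm (fieldWt h (L : ℝ) d k) ((L : ℝ) ^ k) (L ^ (d * k)) (H - H') + pi2BoundConst d (((2 * R + 2 : ℕ) : ℝ) + ((d / 2 + 1 : ℕ) : ℝ)) * (CΔ * A𝒫 * A⁻¹))) + 16 * Real.exp (3 / 8) * hamNorm (fieldWt h (L : ℝ) d k) ((L : ℝ) ^ k) (L ^ (d * k)) (H - H') + CΔ) * (ω * A ^ 4)) + (2 * (16 * Real.exp (3 / 8) * (2 * hamNorm (fieldWt h (L : ℝ) d k) ((L : ℝ) ^ k) (L ^ (d * k)) (H - H') + pi2BoundConst d (((2 * R + 2 : ℕ) : ℝ) + ((d / 2 + 1 : ℕ) : ℝ)) * (CΔ * A𝒫 * A⁻¹))) + CΔ) * (κ ^ (L ^ d) * ((2 * κ * max 1 A𝒫) ^ ((2 ^ (d + 1) + 2) ^ d * L ^ d) * (2 : ℝ) ^ ((2 ^ (d + 1) + 2) ^ d * L ^ d)) * A ^ (-((1 + 1 / ((2 * (2 ^ d + 1) + 6 : ℝ)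 ^ d)) - 1) : ℝ))) + ((3 * (16 * Real.exp (3 / 8) * (2 * hamNorm (fieldWt h (L : ℝ) d k) ((L : ℝ) ^ k) (L ^ (d * k)) (H - H') + pi2BoundConst d (((2 * R + 2 : ℕ) : ℝ) + ((d / 2 + 1 : ℕ) : ℝ)) * (CΔ * A𝒫 * A⁻¹))) + 16 * Real.exp (3 / 8) * hamNorm (fieldWt h (L : ℝ) d k) ((L : ℝ) ^ k) (L ^ (d * k)) (H - H') + CΔ) * (ω * A ^ 4)) + ((3 * (16 * Real.exp (3 / 8) * (2 * hamNorm (fieldWt h (L : ℝ) d k) ((L : ℝ) ^ k) (L ^ (d * k)) (H - H') + pi2BoundConst d (((2 * R + 2 : ℕ) : ℝ) + ((d / 2 + 1 : ℕ) : ℝ)) * (CΔ * A𝒫 * A⁻¹))) + 16 * Real.exp (3 / 8) * hamNorm (fieldWt h (L : ℝ) d k) ((L : ℝ) ^ k) (L ^ (d * k)) (H - H') + CΔ) * (ω * A ^ 4))) * (A ^ (blocks (L * L ^ k) U).card)⁻¹ := by ring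
  rw [← hfin]
  have h0 := le_refl (CΔ * ((L : ℝ) ^ d * (A𝒫 * abkmContrConst d L R) + largePartEps d L A A𝒫 (1 + 1 / ((2 * (2 ^ d + 1) + 6 : ℝ) ^ d)) + largePartEps d L A A𝒫 (1 + 1 / ((2 * (2 ^ d + 1) + 6 : ℝ) ^ d))) * (A ^ (blocks (L * L ^ k) U).card)⁻¹)
  have h1 := le_refl (((L ^ d : ℕ) : ℝ) * κ ^ (L ^ d) * ((16 * Real.exp (3 / 8) * (2 * hamNorm (fieldWt h (L : ℝ) d k) ((L : ℝ) ^ k) (L ^ (d * k)) (H - H') + pi2BoundConst d (((2 * R + 2 : ℕ) : ℝ) + ((d / 2 + 1 : ℕ) : ℝ)) * (CΔ * A𝒫 * A⁻¹))) * (((1 + 8 * pi2BoundConst d (((2 * R + 2 : ℕ) : ℝ) + ((d / 2 + 1 : ℕ) : ℝ))) * (C * A𝒫 * A⁻¹)) + 256 * Real.exp (1 / 4) * ((A𝒫 + 4) * b ^ 2 + 2 * b * (pi2BoundConst d (((2 * R + 2 : ℕ) : ℝ) + ((d / 2 + 1 : ℕ) : ℝ)) * (C * A𝒫 * A⁻¹))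 + (pi2BoundConst d (((2 * R + 2 : ℕ) : ℝ) + ((d / 2 + 1 : ℕ) : ℝ)) * (C * A𝒫 * A⁻¹)) ^ 2)) + 16 * Real.exp (3 / 8) * (2 * b + pi2BoundConst d (((2 * R + 2 : ℕ) : ℝ) + ((d / 2 + 1 : ℕ) : ℝ)) * (C * A𝒫 * A⁻¹)) * ((1 + 8 * pi2BoundConst d (((2 * R + 2 : ℕ) : ℝ) + ((d / 2 + 1 : ℕ) : ℝ))) * (CΔ * A𝒫 * A⁻¹)) + (512 * Real.exp (1 / 4) * (A𝒫 + 4) * (b + b) * hamNorm (fieldWt h (L : ℝ) d k) ((L : ℝ) ^ k) (L ^ (d * k)) (H - H') + 512 * Real.exp (1 / 4) * (hamNorm (fieldWt h (L : ℝ) d k) ((L : ℝ) ^ k) (L ^ (d * k)) (H - H') * (pi2BoundConst d (((2 * R + 2 : ℕ) : ℝ) + ((d / 2 + 1 : ℕ) : ℝ)) * (C * A𝒫 * A⁻¹)) + b * (pi2BoundConst d (((2 * R + 2 : ℕ) : ℝ) + ((d / 2 + 1 : ℕ) : ℝ)) * (CΔ * A𝒫 * A⁻¹))) + 256 * Real.exp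 (1 / 4) * (pi2BoundConst d (((2 * R + 2 : ℕ) : ℝ) + ((d / 2 + 1 : ℕ) : ℝ)) * (C * A𝒫 * A⁻¹) + pi2BoundConst d (((2 * R + 2 : ℕ) : ℝ) + ((d / 2 + 1 : ℕ) : ℝ)) * (CΔ * A𝒫 * A⁻¹)) * (pi2BoundConst d (((2 * R + 2 : ℕ) : ℝ) + ((d / 2 + 1 : ℕ) : ℝ)) * (CΔ * A𝒫 * A⁻¹)))) * (A * (A ^ (blocks (L * L ^ k) U).card)⁻¹))
  exact add_le_add (add_le_add (add_le_add (add_le_add h0 h1) (add_le_add e34 e2B)) e34) e34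

end Literature.MathematicalPhysics.StatisticalMechanics.GradientRG

end
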